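import Literature.NumberTheory.EllipticCurves.Hsieh2014.AnticyclotomicPAdicLFunctionRamifiedTwistedSteinberg
import HarnessLib

/-!
# Hsieh 2014, Theorems A and B (= Thm. 1–2 of the e-print) for a curve ADDITIVE at the `K`-RAMIFIED prime `2` with
# `E/K_𝔮` NON-SPLIT MULTIPLICATIVE — `𝔫⁻ = 2 ∥ N_g` for `g = f_E ⊗ χ_t = f_{W₁}`, `t ∈ {−1, 2, −2}`, branch `λ = ν·λ_E`
# with `ν = χ_{4t} ∘ N_{K/ℚ}` the genus character —, every odd `ℓ ∣ N` split in `K`, any level at `p`: two named facts,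
# the DYADIC siblings (`ℓ₀ = 2`) of `thmA_exists_isHsiehLFunction_unrPeriod_ramifiedTwistedSteinberg` /
# `thmB_exists_isHsiehLFunction_coeff_norm_eq_one_unrPeriod_ramifiedTwistedSteinberg`

Topic `NumberTheory/EllipticCurves`, sub-directory `Hsieh2014` (namespace = path). Companion of
`Hsieh2014/AnticyclotomicPAdicLFunctionRamifiedTwistedSteinberg.lean` (configuration (S4‴): ONE odd `K`-ramified prime `ℓ₀ ≠ p`
at which `E` is additive of quadratic-twist type, `W₁ = E^{(ℓ₀*)}` multiplicative at `ℓ₀`, `E/K_{λ₀}` non-split multiplicative),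
whose module docstring — print applied to `(π_g, ν·λ)`, (sf), Hypothesis 1 ⟺ (R1), `(λφ)_{λ₀} = 1`, the currency / depletion
paragraph, `C(π_g, νλ)` a unit, `𝔑⁻`, `𝔠(𝒪_K)` — is used VERBATIM AT `ℓ₀ = 2` below and not restated, except for the ONE local
sentence at the prime `𝔮 ∣ 2` of `K`, re-justified here from the held text; the frame `IsHsiehLFunction`, the display
`hsiehInterpolationValue`, (S1)–(S8), (W1)–(W4), (E1)–(E2), (E1″) are the frame file's
(`AnticyclotomicRankinSelbergPAdicLFunction.lean`), and the (S4′) reading at a ramified Steinberg prime `q` (ANY `q`, including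
`q = 2`) is `Hsieh2014/AnticyclotomicPAdicLFunctionRamifiedSteinberg.lean`'s. Ledger item wi-101332 (director-bsd ruling
(661)(A) 2026-08-30, WANTED row R3₂ of the door-D chain; pen memo `run/shared/lean/pub/bsd-addord/planner/g2_3f_enlarge/e21/README.md`
r3 §2–§3c); consumer: door-D chain FIELD 1 step (d) of cruxes stmt-BirchSwinnertonDyer-19358 / -19357
(`TameAnticycRestriction.exists_frame_and_restriction hB …`, `Socket` re-keyed to the dyadic road field). HONEST FRAMING: TWO named
facts (`def … : Prop`, nothing asserted, no `_holds`; net debt +2, as the item asks); nothing about the cruxes or BSD is claimed.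

## The configuration (S4⁗) = (S4‴) at `ℓ₀ = 2`, and why print applies — (π_g, ν·λ), NOT (π_{f_E}, λ)

(S4⁗) `E = W/ℚ` elliptic, `f = f_E ∈ S₂(Γ₀(N))` (`IsNewformOf W f`); `p` odd; `2 ∣ d_K` (the prime `2` RAMIFIED in the
imaginary quadratic `K`, `𝔮² = (2)`, residue degree `1`); `E` additive at `2`, potentially multiplicative of quadratic-twist type:
for one `t ∈ {−1, 2, −2}` the twist `W₁ := E^{(t)}` has MULTIPLICATIVE reduction at `2` (binders `t = -1 ∨ t = 2 ∨ t = -2`,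
`(W.quadraticTwist (t : ℚ)).HasMultiplicativeReductionAtPrime 2` — in place of (S4‴)'s `W^{(ℓ₀*)}`, `ℓ₀* = (−1)^{(ℓ₀−1)/2} ℓ₀`;
here the prime discriminant is `t* := disc ℚ(√t) = 4t ∈ {−4, 8, −8}`); `E/K` NON-SPLIT multiplicative at the prime `𝔮 ∣ 2` of
`K` (binder `NonsplitOverAt`-shaped: `(W.baseChange K).HasMultiplicativeReductionAt v ∧ ¬ …Split…` at every `v ∋ 2`, the
conclusion shape of the tree's `TwistedWanRoad.baseChange_nonsplit_two_of_dyadicClass`); every prime `ℓ ∣ N`, `ℓ ≠ 2`,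
SPLIT in `K`. DISJOINT from (S4‴) (`ℓ₀ ≠ 2` there), from (S4′) (`E` additive at `2`, `4 ∣ N`: applied to `π_{f_E}` itself
`𝔫⁻ ⊇ (4)` is NOT square-free and (sf) fails) and from (S4) (all-split), so nothing typed earlier is restated.
PRINT IS APPLIED TO `π = π_g`, `g := f_E ⊗ χ_t` the newform of `W₁` (level `N_g = N_{W₁}`, `2 ∥ N_g`, the odd primes of `N_g`
= the odd primes of `N`, `a_ℓ(g) = χ_t(ℓ) a_ℓ(f_E)` for odd `ℓ`), AND `λ_g := ν · λ` with `ν := χ_{t*} ∘ N_{K/ℚ}` the GENUS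
character of `K` attached to the prime discriminant `t* ∥ d_K`. WHY `t*` DIVIDES `d_K` AS A PRIME DISCRIMINANT (genus theory of
quadratic fields; local class field theory at `𝔮`): over `ℚ₂`, `E = W₁ ⊗ χ_t` with `W₁` a (possibly unramified-twisted) Tate curve and `χ_t` the
RAMIFIED quadratic character of `ℚ₂(√t)/ℚ₂`; over the ramified `K_𝔮 = ℚ₂(√d_K)`, `E/K_𝔮 = W₁/K_𝔮 ⊗ (χ_t ∘ N)` is multiplicative
iff `χ_t ∘ N_{K_𝔮/ℚ₂}` is unramified iff `K_𝔮(√t)/K_𝔮` is unramified iff `d_K · t` is the square class of a `2`-adic unit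
`≡ 1 (mod 4)`, i.e. iff `d_K = t* · n` with `n ≡ 1 (mod 4)` (a product of the two fundamental discriminants `t*` and `n`; the
tree's `discr K = 4 * t * n`, `n % 8 ∈ {1, 5}` of `TwistedWanRoad.quadraticTwist_discr_nonsplit_at_two_of_dyadicClass`) — so the
binder "`E/K` multiplicative above `2`" already FORCES this shape of `d_K`, and then `ν = χ_{t*} ∘ N = χ_n ∘ N` is a genus
character: everywhere UNRAMIFIED (at `𝔮`: `K_𝔮(√t) = K_𝔮(√n)` with `n ≡ 1 (mod 4)` a `2`-adic unit, an unramified extension),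
of order `≤ 2`, `ν|_{𝔸_ℚ^×} = χ_{t*}² = 1`, `ν(𝔮) = χ_n(2) = (2 ∕ n) ∈ {±1}` (Kronecker symbol; `+1` iff `n ≡ 1 (mod 8)`), so
`𝔠_{νλ} = 𝔠_λ`. BRANCH BOOKKEEPING (as in the sibling): `T_pE = T_pW₁ ⊗ χ_t` and over `K` `χ_t|_{G_K} = ν`, so
`π_{g,K} ⊗ νχ = π_{E,K} ⊗ χ` for every `χ`: the anticyclotomic trivial branch of `E/K` (what the frames
`IsHsiehLFunction ι 𝔭 κ γ f_E …` describe) IS the `ν`-branch of `g`.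
Hsieh's hypotheses for `(π_g, νλ)` [p. 3–4]: `π_g` cuspidal, `ω = 1`, weight `2`; `νλ` of infinity type `(1, −1)`
[p. 3 ll. 20–21] with `νλ|_{𝔸_ℚ^×} = 1`, conductor `𝔠_{νλ} = 𝔠_λ`; `p` an ODD prime [p. 3 l. 24 «Let p be an odd rational prime»]
— the ONLY parity clause of Theorems 1–2: the residue characteristic of `𝔫⁻` is unrestricted —; (ord) ⟺ `p` split;
`𝔫 = N_g`, `𝔫⁻ =` the `𝔮`-part `= (2)` (the only prime of `N_g` not split in `K`; RAMIFIED — in scope: [p. 4 ll. 20–22] «When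
`𝓕 = ℚ`, `π` is unramified at `p` and `𝔫⁻` is only divisible by primes ramified in `𝓚`, `𝓛_Σ(π,λ)` is constructed in [BDP]»),
so **(sf) «𝔫⁻ is square-free» [p. 4 ll. 13–14] HOLDS** (`2 ∥ N_g`) and `π_{g,2} = σ(μ₀|·|^{1/2}, μ₀|·|^{−1/2})` is the unramified
special representation [p. 11 l. 2 «(sf) implies that `π_v` is an unramified special representation if `v ∣ 𝔫⁻_s`»],
`μ₀(ϖ) = a_2(g) = a_2(W₁) ∈ {±1}`; **Hypothesis 1 (= A) [p. 3 l. 22] at the unique place `𝔮 ∣ 2` ⟺ `E/K_𝔮` NON-SPLIT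
multiplicative**, by Hsieh's (R1) [p. 11 ll. 3–4] («For each `v ∈ A(χ)`, `v` is ramified in `𝓚` and `μ′_v χ_v(ϖ_v) = −1`»,
`μ′_v = μ_v ∘ N`; right-hand side garbled in the held TeX, reconstructed as in the (S4′) sibling from Jacquet–Langlands Prop. 3.6
— a residue-characteristic-free local root number formula): `𝔮 ∈ A(νλφ)` (`K_𝔮` a field, `π_{g,2}` special, `νλφ` unramified at
`𝔮`), `𝔮` IS ramified, `(λφ)_𝔮 = 1` ([p. 23 l. 31]: «If `v` is inert or ramified, then `φ_v = 1` as `φ_v` is unramified and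
`p > 2`», for every character through `Γ⁻` — again only `p > 2` is used), `μ₀′(ϖ_𝔮) = μ₀(N ϖ_𝔮) = a_2(W₁)` (residue degree `1`),
`ν_𝔮(ϖ_𝔮) = ν(𝔮)`, so (R1) reads `a_2(W₁) · ν(𝔮) = −1`, i.e. `a_𝔮(E/K) = −1` for `E/K_𝔮 = (W₁ ⊗ ν)/K_𝔮`, an UNRAMIFIED quadratic
twist of the multiplicative `W₁/K_𝔮` — the binder (Silverman App. C §16: `a = −1` at a non-split multiplicative prime). Theorem 2's
extra hypotheses: (1) vacuous (`𝓕 = ℚ`); (2) `ρ̄_p(π_{g,K}) = ρ̄_{W₁,p}|_{G_K} = ρ̄_{E,p}|_{G_K} ⊗ ν̄` absolutely irreducible ⟺ the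
binder on `E/K` (twist by a character), verbatim; (3) `p ∤ ∏_{v∣𝔠⁻_{νλ}} #Δ` vacuous: `𝔠_{νλ} = 𝔠_λ` is supported above the
SPLIT `p`. `C(π_g, νλ) ∈ Z̄_{(p)}^×` as printed [p. 4 l. 18; p. 17 l. 5: «`C′(π, χ)` is actually a unit as `p > 2` and
`(p, ℭ𝔫⁻) = 1`» — here `(p, ℭ·2) = 1`, `p` odd]. Everything else ((S1)–(S3), (S6)–(S8), (W1)–(W4), (E1), (E1″), (E2), the
`R₀`-unit period, `𝔑⁻ = 𝔮`, `𝔑⁺ = ℭℭ̄` from the split odd primes, `𝔠(𝒪_K) = (2δ)𝒟_{K/ℚ} = (c)` with `c` prime to `pN` hence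
odd, prime to `p𝔑𝔑̄`) is the siblings' reading for `(π_g, νλ)`, word for word.

## The currency: the EXISTING `f_E`-keyed frame, and the `𝔮`-LOCAL-FACTOR (depletion) constant `1 + 2⁻¹ = 3/2`

As in the sibling (its §«The currency», (i)–(iii), read at `ℓ₀ = 2`): the conclusion is typed on the EXISTING frame
`IsHsiehLFunction ι 𝔭 κ γ f_E A Ω_K C Ω_p Q` (display `hsiehInterpolationValue p f_E 𝔭 χ n A Ω_K C`). Hsieh's element for
`(π_g, νλ)` gives a frame keyed to `(g, νχ)`; the two displays AGREE TERM BY TERM except at ONE Euler factor: (i) at `𝔭`: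
`a_p(g) ν(𝔭) = χ_t(p) a_p(E) χ_t(p) = a_p(E)` (`p` odd, split; `ν(𝔭) = χ_{t*}(N𝔭) = χ_t(p)`), so the `p`-Euler data agree
(`p ∣ N_g ⟺ p ∣ N_E`); (ii) at every finite `v ∤ 2`: `α_g^k + β_g^k = χ_t(ℓ)^k (α^k + β^k)` against `ν(v) χ(ϖ_v) = χ_t(ℓ)^k χ(ϖ_v)`
(`N(v) = ℓ^k`), `ν(v)² = 1`, `ℓ ∤ N_g ⟺ ℓ ∤ N_E`; (iii) at `v = 𝔮 ∣ 2` the `f_E`-keyed factor is `1` (`a_2(f_E) = 0`: `E` additive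
at `2`, `4 ∣ N_E`) while the honest `g`-keyed factor is `1 − a_2(g) ν(𝔮) χ(ϖ_𝔮) 2^{−s} = 1 + 2^{−s}` (non-split; `χ(ϖ_𝔮) = 1` on the
range). Hence `rankinSelbergValueHecke f_E χ 1 = (1 + 2⁻¹) · rankinSelbergValueHecke g (νχ) 1 = (3/2) · (…)` — the `f_E`-keyed value
is the `𝔮`-DEPLETED one — and `hsiehInterpolationValue p f_E 𝔭 χ n A Ω_K C = (3/2) · [Hsieh's display for (g, νχ) with the same
A, Ω_K, C]` (a KERNEL statement about `rankinSelbergLocalFactorInvHecke`, recorded as the reading; not print). CONSEQUENCE: with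
`Q := (3/2) · Q_g ∈ 𝒪_{ℂ_p}⟦T⟧` (`3/2 ∈ ℤ_p`, `p` odd), Theorem A's frame TRANSFERS with no further hypothesis (`thmA_…` below
carries none); Theorem B's "a coefficient of norm one" (`μ = 0`) transfers iff `‖3/2‖_p = 1`, i.e. iff `p ≠ 3` — the binder
`¬ p ∣ 2 + 1` of `thmB_…` below, kept in the siblings' spelling `¬ p ∣ ℓ₀ + 1` at `ℓ₀ = 2` (door-D rows have `p ≥ 5`; the row
`p = 3` would need the `(g, ν)`-keyed primitive frame — NOT typed here). The factor cannot be moved into `C` (`‖ι⁻¹C‖ = 1`),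
`Ω_p` (a unit) or `A, Ω_K` (they enter with `n`-dependent powers).

WEAKER than print on its range (special case `𝓕 = ℚ`, `κ = 2`, `π = π_g` for `g` the `χ_t`-twist of `f_E`, branch `ν·λ`,
`𝔫⁻ = (2)` ramified, unramified critical characters, consequence-shaped conclusions, the depleted `f_E`-keyed display), never
knowingly stronger. NOT typed, NOT asserted: the `(g, ν)`-keyed primitive frame (row `p = 3`); `Q ∈ R₀⟦T⟧`; any comparison with
the `IsBDPLFunction` / LZZ / JSW normalisations; `2` inert or split in `K`; odd `ℓ₀` (the sibling).
-- TODO(general form): as in the siblings (totally real `𝓕`, general `𝔫⁻`, `𝔠_λ⁻ ≠ (1)`), and the primitive `(g, ν)`-keyed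
-- frame serving the row `p = 3`.

## References

* [Hsieh2014] M.-L. Hsieh, Doc. Math. 19 (2014) 709–767 = arXiv:1112.1580 (held `paper:arxiv-1112.1580`, re-read for this file at
  the page: `[p0003 L14–L22]` (`𝔞 = 𝔞⁺𝔞⁻`, `ε*`, Hypothesis 1), `[p0003 L20–L21]` (infinity types of `π`, `λ`), `[p0003 L24]` («Let
  `p` be an odd rational prime» — the only parity clause), `[p0004 L13–L18]` (Thm. 1 with (sf) and the display,
  `C(π,λ) ∈ Z̄_{(p)}^×`), `[p0004 L20–L22]` (`𝔫⁻` ramified in scope: «is constructed in [BDP]»), `[p0004 L30–L37]` (Thm. 2 (1)–(3)),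
  `[p0011 L2–L4]` ((sf) ⟹ unramified special; (R1) «`v` is ramified in `𝓚` and `μ′_v χ_v(ϖ_v) = −1`», right-hand side garbled
  in the held TeX, reconstructed as in the siblings), `[p0017 L5]` («`C′(π,χ)` is actually a unit as `p > 2` and
  `(p, ℭ𝔫⁻) = 1`»), `[p0023 L31]` («If `v` is inert or ramified, then `φ_v = 1` as `φ_v` is unramified and `p > 2`»),
  `[p0025]` (Thm. 6.2)). No sentence of Theorems 1–2 or §§3–6 restricts the residue characteristic of a prime of `𝔫⁻`
  (searched: «dyadic», «residue characteristic», «v ∣ 2», «2 ∤»: none; the coprimality `(𝔫, 𝒟_{𝓚/𝓕}) = 1` occurs only in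
  Theorem C / §7 [p0005 L31–L33, p0027 L8–L14], not used here).
* [JacquetLanglands1970] Prop. 3.6; [Bump1997] (5.52)–(5.53); [SilvermanAEC2009] App. C §16 p. 449 (`a = −1` at non-split
  multiplicative primes) — as in the siblings.
* Pen memo e21 r3 (cell `pub/bsd-addord`) §2–§3c: door D (`E` additive at `2` of quadratic-twist type, `W₁ = E^{(t)}`
  multiplicative at `2`, `K` with `2` ramified, `d_K = 4·t·n`, genus character `ν = χ_{t*} ∘ N`, `λ₀`-depletion `3/2`); e19 v6 §4 (d),
  BRANCH BOOKKEEPING, PRINT-STATUS CHECK, ERRATUM (1)–(3) — as in the sibling.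
* Tree: the siblings `Hsieh2014/AnticyclotomicPAdicLFunctionRamifiedTwistedSteinberg.lean` (p790378) and
  `…RamifiedSteinberg.lean`; `Summits/…/Theorems/AdditiveBranchIMCGordTwoTwistedDyadicClass.lean` (p814401:
  `TwistedWanRoad.quadraticTwist_discr_nonsplit_at_two_of_dyadicClass`, `baseChange_nonsplit_two_of_dyadicClass` — the class
  clause ⟹ the binder "`E/K` non-split multiplicative above `2`"); `DiophantineGeometry/LocalReduction.lean`
  (`HasMultiplicativeReductionAt`, `HasSplitMultiplicativeReductionAt` over `𝓞 K`); `EllipticCurves/Tamagawa.lean`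
  (`HasMultiplicativeReductionAtPrime`).
-/

noncomputable section

open scoped MatrixGroups ModularForm Topology NumberField
open CongruenceSubgroup NumberField IsDedekindDomain Field
open Literature.NumberTheory.GaloisRepresentations
open Literature.NumberTheory.EllipticCurves.ModularForms
open Literature.NumberTheory.Automorphic

namespace Literature.NumberTheory.EllipticCurves.Hsieh2014

/-! ### §1. Theorem A (= Thm. 1) for the `ν`-branch of `g = f_E ⊗ χ_t`, `t ∈ {−1, 2, −2}`, in the `f_E`-keyed frame -/

/-- **Hsieh, Doc. Math. 19 (2014), Theorem A (p. 712) = Thm. 1 [arXiv:1112.1580 pp. 3–4], WITH THE `p`-ADIC CM PERIOD IN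
`𝒲^× = R₀^×`, AT ANY LEVEL AT `p`, APPLIED TO `(π_g, ν·λ)` FOR `E` ADDITIVE AT THE `K`-RAMIFIED PRIME `2` WITH `E/K_𝔮`
NON-SPLIT MULTIPLICATIVE** — the named fact `thmA_exists_isHsiehLFunction_unrPeriod_ramifiedTwistedSteinberg` VERBATIM (same
binders in the same order, same conclusion `∃ A Ω_K C Ω_p Q, 0 < A ∧ Ω_K ≠ 0 ∧ ‖ι⁻¹C‖ = 1 ∧ IsHsiehLFunction ι 𝔭 κ γ f A Ω_K C Ω_p Q`),
EXCEPT that the configuration (S4‴) at the odd prime `ℓ₀` is REPLACED by (S4⁗) of the module docstring at the prime `2`: the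
binders `ℓ₀ ≠ p → ℓ₀ ≠ 2 → (ℓ₀ : ℤ) ∣ d_K → W^{(ℓ₀*)} multiplicative at ℓ₀ → (E/K non-split multiplicative above ℓ₀) → (every
ℓ ∣ N, ℓ ≠ ℓ₀, split)` become `(t = −1 ∨ t = 2 ∨ t = −2) → (2 : ℤ) ∣ d_K → W^{(t)} multiplicative at 2 → (E/K non-split
multiplicative above 2) → (every ℓ ∣ N, ℓ ≠ 2, split)` for a new binder `t : ℤ` (`ℓ₀ ≠ p`, `ℓ₀ ≠ 2` are absorbed by `p ≠ 2`,
`ℓ₀ := 2`). Justification (module docstring): print is applied to `π_g`, `g = f_E ⊗ χ_t` (`2 ∥ N_g`: (sf) holds; a ramified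
`𝔫⁻` is in scope [p. 4 ll. 20–22]; the only parity clause of Thm. 1 is «`p` odd» [p. 3 l. 24]) and `λ_g = ν·λ`, `ν = χ_{4t} ∘ N`
the everywhere-unramified genus character (`d_K = 4t·n`, `n ≡ 1 (mod 4)`, forced by the multiplicativity of `E/K` above `2`;
`𝔠_{νλ} = 𝔠_λ`); Hypothesis 1 at the unique place `𝔮 ∣ 2` ⟺ `a_2(W₁)·ν(𝔮) = −1` ⟺ `E/K_𝔮` non-split multiplicative, by (R1)
[p. 11 ll. 3–4] and «`φ_v = 1`» [p. 23 l. 31]; the `(g, νχ)`-display equals `hsiehInterpolationValue p f_E 𝔭 χ n A Ω_K C`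
divided by the constant `1 + 2⁻¹ = 3/2` (the `f_E`-keyed Rankin–Selberg value is the `𝔮`-depleted one), so
`Q := (3/2)·Q_g ∈ 𝒪_{ℂ_p}⟦T⟧` serves — no further hypothesis for Theorem A. WEAKER than print (special case; depleted
display), never stronger; DISJOINT from (S4), (S4′), (S4‴). NOT asserted: `Q ∈ R₀⟦T⟧`. Named fact; nothing asserted; no `_holds`.
[cite: Hsieh2014, Thm. A p. 712 (Doc. Math. 19) = Thm. 1 (arXiv:1112.1580 pp. 3–4), p. 3 ll. 14–24 (𝔫⁻, Hyp. 1, p odd), p. 4 ll. 13–22 ((sf); 𝔫⁻ ramified in scope), §3.5 (R1) (p. 11 ll. 1–4), proof of Lemma 5.4 (p. 23 l. 31), p. 17 l. 5]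
[cite: JacquetLanglands1970, Prop. 3.6] [cite: SilvermanAEC2009, App. C §16 p. 449 (L_v(T) = 1 + T at a prime of nonsplit multiplicative reduction)]
[cite: CastellaHsieh2018, §2.5 (arXiv:1505.08165 p. 7)] -/
def thmA_exists_isHsiehLFunction_unrPeriod_ramifiedTwistedSteinbergAtTwo : Prop :=
  ∀ {p : ℕ} [Fact p.Prime] (ι : PadicAlgCl p ≃+* ℂ) (K : Type) [Field K] [NumberField K]
    (𝔭 : HeightOneSpectrum (𝓞 K)) (κ : ZpExtension K p) (γ : absoluteGaloisGroup K)
    {N : ℕ} [NeZero N] (W : WeierstrassCurve ℚ) [W.IsElliptic] (f : CuspForm (Gamma0 N) 2)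
    (t : ℤ) (lam : HeckeCharacter K) (rlam : FramedGaloisRep K (PadicAlgCl p) 1),
    p ≠ 2 → IsNewformOf W f →
    IsImaginaryQuadratic K → ((Ideal.span {(p : ℤ)}).primesOver (𝓞 K)).ncard = 2 →
    ((p : ℕ) : 𝓞 K) ∈ 𝔭.asIdeal →
    (∀ (w : InfinitePlace K) (k : 𝓞 K), k ∈ 𝔭.asIdeal ↔ ‖ι.symm (w.embedding (k : K))‖ < 1) →
    -- (S4⁗): `2` RAMIFIED in `K`; `W₁ = W^{(t)}`, `t ∈ {−1, 2, −2}`, multiplicative at `2`; `E/K` NON-SPLIT multiplicative above `2`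
    (t = -1 ∨ t = 2 ∨ t = -2) → (2 : ℤ) ∣ NumberField.discr K →
    (W.quadraticTwist (t : ℚ)).HasMultiplicativeReductionAtPrime 2 →
    (∀ v : HeightOneSpectrum (𝓞 K), ((2 : ℕ) : 𝓞 K) ∈ v.asIdeal →
      (W.baseChange K).HasMultiplicativeReductionAt v ∧
        ¬ (W.baseChange K).HasSplitMultiplicativeReductionAt v) →
    (∀ ℓ : ℕ, ℓ.Prime → ℓ ∣ N → ℓ ≠ 2 → ((Ideal.span {(ℓ : ℤ)}).primesOver (𝓞 K)).ncard = 2) →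
    lam.IsUnitary → lam.HasInfinityType (fun _ ↦ (1 : ℤ)) (fun _ ↦ (-1 : ℤ)) →
    (∀ x : ideleGroup ℚ, lam (AdeleRing.ideleBaseChange ℚ K x) = 1) →
    (∀ v : HeightOneSpectrum (𝓞 K), ((p : ℕ) : 𝓞 K) ∉ v.asIdeal → lam.IsUnramifiedAt v) →
    IsPAdicAvatarOf ι lam rlam → FactorsThroughZp κ rlam →
    κ.IsAnticyclotomic → κ.IsTopGenerator γ →
    ∃ (A : ℝ) (ΩK C : ℂ) (Ωp : (unrIntegers p)ˣ) (Q : PowerSeries (PadicComplexInt p)),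
      0 < A ∧ ΩK ≠ 0 ∧ ‖((ι.symm C : PadicAlgCl p) : ℂ_[p])‖ = 1 ∧
        IsHsiehLFunction ι 𝔭 κ γ f A ΩK C ((Ωp : unrIntegers p) : ℂ_[p]) Q

/-! ### §2. Theorem B (= Thm. 2 = Thm. 6.2) for the `ν`-branch of `g`, in the `f_E`-keyed frame, first cut `p ∤ 2 + 1` (`p ≠ 3`) -/

/-- **Hsieh, Doc. Math. 19 (2014), Theorem B (p. 713) = Thm. 2 [arXiv:1112.1580 p. 4 ll. 31–37] = Thm. 6.2 [p. 25], WITH THE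
`p`-ADIC CM PERIOD IN `𝒲^× = R₀^×`, AT ANY LEVEL AT `p`, APPLIED TO `(π_g, ν·λ)` FOR `E` ADDITIVE AT THE `K`-RAMIFIED PRIME `2`
WITH `E/K_𝔮` NON-SPLIT MULTIPLICATIVE, ON THE FIRST CUT `p ∤ 2 + 1`** — the named fact
`thmB_exists_isHsiehLFunction_coeff_norm_eq_one_unrPeriod_ramifiedTwistedSteinberg` VERBATIM (same binders in the same order,
same conclusion: a frame `(A, Ω_K, C, Ω_p, Q)` with `IsHsiehLFunction ι 𝔭 κ γ f A Ω_K C Ω_p Q` AND a coefficient of `Q` of norm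
one), EXCEPT that (S4‴) is REPLACED by (S4⁗) of the module docstring (`t ∈ {−1, 2, −2}`, `2 ∣ d_K`, `W^{(t)}` multiplicative at
`2`, `E/K` non-split multiplicative above `2`, every odd `ℓ ∣ N` split) AND the unit-cut binder `¬ p ∣ ℓ₀ + 1` is read at
`ℓ₀ = 2`: `¬ p ∣ 2 + 1` (`p ≠ 3`). Justification (module docstring): Theorem 1's hypotheses for `(π_g, νλ)` as at
`thmA_…_ramifiedTwistedSteinbergAtTwo`; Theorem 2's (1) vacuous, (2) = the binder "every framed mod-`p` representation of `E/K` is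
absolutely irreducible" (`ρ̄_{g}|_{G_K} = ρ̄_{E}|_{G_K} ⊗ ν̄`), (3) vacuous (`𝔠_{νλ} = 𝔠_λ` above the split `p`); `μ⁻ = 0` gives a
norm-one coefficient of `Q_g`, and the `f_E`-keyed `Q = (3/2)·Q_g` keeps one iff `‖3/2‖_p = 1`, i.e. `p ≠ 3` (the depleted
display is a UNIT multiple of the primitive one exactly on this cut; the row `p = 3` needs a `(g, ν)`-keyed frame, not typed).
WEAKER than print (special case, depleted display, the cut), never stronger; DISJOINT from (S4), (S4′), (S4‴). Named fact;
nothing asserted; no `_holds`.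
[cite: Hsieh2014, Thm. B p. 713 (Doc. Math. 19) = Thm. 2 (arXiv:1112.1580 p. 4 ll. 31–37), p. 3 l. 24 (p odd), §3.5 (R1) (p. 11 ll. 1–4), proof of Lemma 5.4 (p. 23 l. 31), Thm. 6.1–6.2 (p. 25), Remark 6.4 (p. 26)]
[cite: JacquetLanglands1970, Prop. 3.6] [cite: SilvermanAEC2009, App. C §16 p. 449 (L_v(T) = 1 + T at a prime of nonsplit multiplicative reduction)] [cite: CastellaHsieh2018, §2.5 (arXiv:1505.08165 p. 7)] -/
def thmB_exists_isHsiehLFunction_coeff_norm_eq_one_unrPeriod_ramifiedTwistedSteinbergAtTwo : Prop :=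
  ∀ {p : ℕ} [Fact p.Prime] (ι : PadicAlgCl p ≃+* ℂ) (K : Type) [Field K] [NumberField K]
    (𝔭 : HeightOneSpectrum (𝓞 K)) (κ : ZpExtension K p) (γ : absoluteGaloisGroup K)
    {N : ℕ} [NeZero N] (W : WeierstrassCurve ℚ) [W.IsElliptic] (f : CuspForm (Gamma0 N) 2)
    (t : ℤ) (lam : HeckeCharacter K) (rlam : FramedGaloisRep K (PadicAlgCl p) 1),
    p ≠ 2 → IsNewformOf W f →
    IsImaginaryQuadratic K → ((Ideal.span {(p : ℤ)}).primesOver (𝓞 K)).ncard = 2 →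
    ((p : ℕ) : 𝓞 K) ∈ 𝔭.asIdeal →
    (∀ (w : InfinitePlace K) (k : 𝓞 K), k ∈ 𝔭.asIdeal ↔ ‖ι.symm (w.embedding (k : K))‖ < 1) →
    -- (S4⁗) and the first-cut binder `p ∤ 2 + 1`
    (t = -1 ∨ t = 2 ∨ t = -2) → (2 : ℤ) ∣ NumberField.discr K →
    (W.quadraticTwist (t : ℚ)).HasMultiplicativeReductionAtPrime 2 →
    (∀ v : HeightOneSpectrum (𝓞 K), ((2 : ℕ) : 𝓞 K) ∈ v.asIdeal →
      (W.baseChange K).HasMultiplicativeReductionAt v ∧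
        ¬ (W.baseChange K).HasSplitMultiplicativeReductionAt v) →
    (∀ ℓ : ℕ, ℓ.Prime → ℓ ∣ N → ℓ ≠ 2 → ((Ideal.span {(ℓ : ℤ)}).primesOver (𝓞 K)).ncard = 2) →
    ¬ p ∣ 2 + 1 →
    (∀ ρ : ModPGaloisRep K (ZMod p) 2, (W.baseChange K).IsTorsionGaloisRep p ρ →
      FramedRep.IsAbsolutelyIrreducible ρ) →
    lam.IsUnitary → lam.HasInfinityType (fun _ ↦ (1 : ℤ)) (fun _ ↦ (-1 : ℤ)) →
    (∀ x : ideleGroup ℚ, lam (AdeleRing.ideleBaseChange ℚ K x) = 1) →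
    (∀ v : HeightOneSpectrum (𝓞 K), ((p : ℕ) : 𝓞 K) ∉ v.asIdeal → lam.IsUnramifiedAt v) →
    IsPAdicAvatarOf ι lam rlam → FactorsThroughZp κ rlam →
    κ.IsAnticyclotomic → κ.IsTopGenerator γ →
    ∃ (A : ℝ) (ΩK C : ℂ) (Ωp : (unrIntegers p)ˣ) (Q : PowerSeries (PadicComplexInt p)),
      0 < A ∧ ΩK ≠ 0 ∧ ‖((ι.symm C : PadicAlgCl p) : ℂ_[p])‖ = 1 ∧
        IsHsiehLFunction ι 𝔭 κ γ f A ΩK C ((Ωp : unrIntegers p) : ℂ_[p]) Q ∧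
        ∃ n : ℕ, ‖((PowerSeries.coeff n Q : PadicComplexInt p) : ℂ_[p])‖ = 1

end Literature.NumberTheory.EllipticCurves.Hsieh2014

end
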